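import Literature.NumberTheory.EllipticCurves.KodairaNeronMultiplicativeProofs
import Literature.NumberTheory.EllipticCurves.HasseWeilAbelianEulerFactorKodairaNeronProofs
import Literature.NumberTheory.EllipticCurves.InertiaInvariantsMultiplicativeProofs
import HarnessLib

/-!
# Kodaira–Néron over `K_v^nr` at every place, and the Euler factors of the Tate module of an
# elliptic curve over a number field, unconditionally (Silverman *AEC* C.§16 / Serre–Tate Thm. 3)

`Proofs` file (theorems only, no definitions, no named facts) in topic
`NumberTheory/EllipticCurves`, landed for the named fact
`Literature.NumberTheory.EllipticCurves.LFunction_eq_of_isIsogenous` (Knapp, *Elliptic Curves*,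
Thm. 11.67).  It closes the Euler-factor programme of `HasseWeilAbelianEulerFactorElliptic` /
`…Torsion` / `…Frobenius` / `…KodairaNeronProofs`:

* `WeierstrassCurve.reducesToNonsingular_of_hasGoodReduction`,
  `WeierstrassCurve.kodairaNeron_exists_finset_reducesToNonsingular_of_hasGoodReduction`: at a
  place of good reduction every point of `X(K̄_v)` has nonsingular reduction, so the Kodaira–Néron
  named fact `kodairaNeron_exists_finset_reducesToNonsingular` (`KodairaNeronUnramified`) holds
  with `T = {O}`;
* `WeierstrassCurve.kodairaNeron_exists_finset_reducesToNonsingular_localMinimalModel`: **the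
  Kodaira–Néron finiteness over `K_v^nr` holds for the minimal model of an elliptic curve over a
  number field at every finite place** (good: this file; multiplicative:
  `KodairaNeronMultiplicativeProofs`; additive: `KodairaNeronAdditiveProofs`) — Silverman, *AEC*,
  Cor. VII.6.2 as applied over `K^nr` in the proof of Thm. VII.7.1;
* `WeierstrassCurve.serreTate_frobenius_smul_torsion_of_hasSplitMultiplicativeReductionAt_holds`,
  `WeierstrassCurve.serreTate_frobenius_smul_torsion_of_hasNonsplitMultiplicativeReductionAt_holds`:
  **the two Frobenius torsion facts (Serre–Tate §1 Lemma 2 at the multiplicative places) are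
  theorems**;
* `WeierstrassCurve.hasseWeilEulerFactor_geomPoints_of_isElliptic_holds`: **the corrected
  Euler-factor fact `det(1 - σ_v T ∣ (V_ℓ E)_{I_v}) = L_v(E, T)` at every `v ∤ ℓ` (Silverman,
  *AEC*, C.§16; Serre–Tate, Thm. 3) is a theorem** for every elliptic curve over a number field
  and every prime `ℓ`, and `WeierstrassCurve.hasseWeilEulerFactor_geomPoints_holds_of_isElliptic`:
  the schema instance `hasseWeilEulerFactor_geomPoints W ℓ` (`HasseWeilAbelian`) for elliptic `W`
  — the hypothesis of `LFunction_eq_of_isIsogenous_of_hasseWeilEulerFactor_geomPoints`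
  (`ComplexMultiplicationLFunctionIsogenyProofs`, Knapp 11.67).

## References

* J. H. Silverman, *The Arithmetic of Elliptic Curves*, 2nd ed. (2009): Prop. VII.5.1(a)
  (good reduction: `Ẽ` nonsingular), Cor. VII.6.2 and the proof of Thm. VII.7.1 (PDF pp. 177–179),
  §C.16 (PDF p. 390). [SilvermanAEC2009]
* J.-P. Serre, J. Tate, *Good reduction of abelian varieties*, Ann. of Math. 88 (1968), §1
  Lemma 2, §2 Thm. 3. [SerreTate1968]
* J. H. Silverman, *Advanced Topics in the Arithmetic of Elliptic Curves* (1994), Cor. IV.9.2(d),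
  Thm. IV.10.2(a). [SilvermanATAEC1994]

## Design

No definitions; theorems only; `open scoped Classical NNReal`; one universe `u`; the rings
`K_v`, `K̄_v`, `K_v^nr`, `𝒪ⁿʳ`, `𝓞_v` are spelled out as expressions, as in
`KodairaNeronAdditiveProofs`.
-/

noncomputable section

open scoped Classical NNReal
open NumberField IsDedekindDomain Field Polynomial IsLocalRing

universe u

namespace WeierstrassCurve

open Literature.NumberTheory.EllipticCurves Literature.NumberTheory.GaloisRepresentations
  Literature.NumberTheory.GaloisRepresentations.IsNonarchimedeanLocalField
  IsDedekindDomain.HeightOneSpectrum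

/-! ## Good reduction: every point has nonsingular reduction -/

section Good

variable {K : Type u} [Field K] [NumberField K] {v : HeightOneSpectrum (𝓞 K)}
  {w : Valuation (AlgebraicClosure (v.adicCompletion K)) ℝ≥0}
  (hw : ∀ x, (w x : ℝ) = spectralNorm (v.adicCompletion K) (AlgebraicClosure (v.adicCompletion K)) x)

include hw in
set_option maxHeartbeats 1600000 in
/-- **At a place of good reduction every point of `X(K̄_v)` lies in `E₀`** (for the spectral
valuation `|·|_v`): for a minimal `X/K_v` with good reduction the integral model `X₀` has unit
discriminant, so its reduction — over the residue field of `𝒪_w` as well — is nonsingular and every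
point on it is a nonsingular point (Silverman, *AEC*, Prop. VII.5.1(a): "`E` has good reduction
iff `Ẽ` is nonsingular"; then `E₀ = E`).  The point is transported to the `𝒪_w`-model
`X₀ ⊗ 𝒪_w` of `X ⊗ K̄_v` (bridge `reducesToNonsingular_iff_hasNonsingularReduction`).
Deliberate dot-notation extension of Mathlib's `WeierstrassCurve`.
[cite: SilvermanAEC2009, Prop. VII.5.1(a) (PDF p. 196)] -/
theorem reducesToNonsingular_of_hasGoodReduction (X : WeierstrassCurve (v.adicCompletion K))
    (hgood : X.HasGoodReduction (v.adicCompletionIntegers K))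
    (P : (X.baseChange (AlgebraicClosure (v.adicCompletion K))).toAffine.Point) :
    ReducesToNonsingular w (residue w.integer) P := by
  obtain ⟨φ, hφ⟩ := exists_ringHom_adicCompletionIntegers_unrIntegers hw
  obtain ⟨ψ, hψ⟩ := exists_ringHom_unrIntegers_integer (w := w)
  have hvw : w.Integers w.integer := Valuation.integer.integers w
  have hX₀K : (X.integralModel (v.adicCompletionIntegers K)).baseChange (v.adicCompletion K) = X :=
    WeierstrassCurve.baseChange_integralModel_eq (v.adicCompletionIntegers K) X
  -- the `𝒪_w`-model `W₀ = X₀ ⊗ 𝒪_w` of `X ⊗ K̄_v`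
  have hW₀ : (((X.integralModel (v.adicCompletionIntegers K)).map φ).map ψ).baseChange
      (AlgebraicClosure (v.adicCompletion K)) =
        X.baseChange (AlgebraicClosure (v.adicCompletion K)) := by
    conv_rhs => rw [← hX₀K]
    change (((X.integralModel (v.adicCompletionIntegers K)).map φ).map ψ).map (algebraMap _ _) =
      ((X.integralModel (v.adicCompletionIntegers K)).map
        (algebraMap (v.adicCompletionIntegers K) (v.adicCompletion K))).map
          (algebraMap (v.adicCompletion K) (AlgebraicClosure (v.adicCompletion K)))
    rw [WeierstrassCurve.map_map, WeierstrassCurve.map_map, WeierstrassCurve.map_map]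
    congr 1
    refine RingHom.ext fun a ↦ ?_
    change ((ψ (φ a) : w.integer) : (AlgebraicClosure (v.adicCompletion K))) =
      algebraMap (v.adicCompletion K) (AlgebraicClosure (v.adicCompletion K))
        (algebraMap (v.adicCompletionIntegers K) (v.adicCompletion K) a)
    rw [hψ, hφ]
    rfl
  -- its reduction is nonsingular: `Δ(X₀)` is a unit
  have hΔu : IsUnit (X.integralModel (v.adicCompletionIntegers K)).Δ := by
    have h := hgood.goodReduction
    rw [← WeierstrassCurve.integralModel_Δ_eq (v.adicCompletionIntegers K) X,
      valuation_of_algebraMap] at h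
    have h' : (X.integralModel (v.adicCompletionIntegers K)).Δ ∉
        maximalIdeal (v.adicCompletionIntegers K) := intValuation_eq_one_iff.mp h
    by_contra hu
    exact h' ((IsLocalRing.mem_maximalIdeal _).mpr (mem_nonunits_iff.mpr hu))
  have hΔk : ((((X.integralModel (v.adicCompletionIntegers K)).map φ).map ψ).map
      (residue w.integer)).Δ ≠ 0 := by
    rw [WeierstrassCurve.map_Δ, WeierstrassCurve.map_Δ, WeierstrassCurve.map_Δ]
    exact (residue_ne_zero_iff_isUnit _).mpr ((hΔu.map φ).map ψ)
  -- transport `P` to the `𝒪_w`-model and conclude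
  rw [← (WeierstrassCurve.Affine.Point.congrEquiv hW₀).apply_symm_apply P,
    reducesToNonsingular_congrEquiv_iff, reducesToNonsingular_iff_hasNonsingularReduction]
  rcases point_cases hvw ((WeierstrassCurve.Affine.Point.congrEquiv hW₀).symm P) with
    h0 | ⟨x, y, h, hP, hx⟩ | ⟨a, b, h, hP⟩
  · rw [h0]; exact hasNonsingularReduction_zero
  · rw [hP]; exact Or.inl ((not_mem_range_iff hvw).mpr hx)
  · rw [hP]
    refine (WeierstrassCurve.hasNonsingularReduction_some_algebraMap_iff hvw.hom_inj h).mpr ?_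
    have he : (((X.integralModel (v.adicCompletionIntegers K)).map φ).map ψ).toAffine.Equation
        a b := (WeierstrassCurve.Affine.map_equation _ hvw.hom_inj a b).mp h.left
    exact (WeierstrassCurve.Affine.equation_iff_nonsingular_of_Δ_ne_zero hΔk).mp
      (he.map (residue w.integer))

/-- **Kodaira–Néron over `K_v^nr` at a place of good reduction** (trivially: `E₀ = E`): the named
fact `kodairaNeron_exists_finset_reducesToNonsingular` of `KodairaNeronUnramified` for a minimal
`X/K_v` with good reduction, with the single representative `O`.
Deliberate dot-notation extension of Mathlib's `WeierstrassCurve`.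
[cite: SilvermanAEC2009, Prop. VII.5.1(a) and Cor. VII.6.2 (PDF pp. 196, 177)] -/
theorem kodairaNeron_exists_finset_reducesToNonsingular_of_hasGoodReduction
    (X : WeierstrassCurve (v.adicCompletion K))
    (hgood : X.HasGoodReduction (v.adicCompletionIntegers K)) :
    X.kodairaNeron_exists_finset_reducesToNonsingular := by
  intro _ _ w hw 𝔐 h𝔐
  refine ⟨{0}, fun t ht σ _ ↦ ?_, fun P _ ↦ ⟨0, Finset.mem_singleton_self _, ?_⟩⟩
  · rw [Finset.mem_singleton.mp ht]
    rfl
  · rw [sub_zero]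
    exact X.reducesToNonsingular_of_hasGoodReduction hw hgood P

/-- **Kodaira–Néron over `K_v^nr` for elliptic curves over number fields, at every finite place.**
For an elliptic curve `E/K` over a number field and a finite place `v`, the named fact
`kodairaNeron_exists_finset_reducesToNonsingular` (`KodairaNeronUnramified`: `E(K_v^nr)/E₀(K_v^nr)`
is finite for the minimal model `W.localMinimalModel v`; Silverman, *AEC*, Cor. VII.6.2 as applied
over `K^nr` in the proof of Thm. VII.7.1, *ATAEC* Cor. IV.9.2(d)) holds: by the local trichotomy,
from the good case (this file), the multiplicative case
(`kodairaNeron_exists_finset_reducesToNonsingular_of_hasMultiplicativeReductionAt`,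
`KodairaNeronMultiplicativeProofs`) and the additive case
(`kodairaNeron_exists_finset_reducesToNonsingular_of_hasAdditiveReductionAt`,
`KodairaNeronAdditiveProofs`).  Deliberate dot-notation extension of Mathlib's `WeierstrassCurve`.
[cite: SilvermanAEC2009, Cor. VII.6.2 with Thm. VII.6.1, as applied over `K^nr` in the proof of Thm. VII.7.1 (PDF pp. 177–179)]
[cite: SilvermanATAEC1994, Cor. IV.9.2(d) (PDF p. 340)] -/
theorem kodairaNeron_exists_finset_reducesToNonsingular_localMinimalModel
    (W : WeierstrassCurve K) [W.IsElliptic] (v : HeightOneSpectrum (𝓞 K)) :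
    (W.localMinimalModel v).kodairaNeron_exists_finset_reducesToNonsingular := by
  rcases hasGoodReductionAt_or_hasMultiplicativeReductionAt_or_hasAdditiveReductionAt v W with
    hg | hm | ha
  · exact (W.localMinimalModel v).kodairaNeron_exists_finset_reducesToNonsingular_of_hasGoodReduction
      hg
  · exact W.kodairaNeron_exists_finset_reducesToNonsingular_of_hasMultiplicativeReductionAt hm
  · exact W.kodairaNeron_exists_finset_reducesToNonsingular_of_hasAdditiveReductionAt ha

end Good

/-! ## The Frobenius torsion facts and the Euler factors, unconditionally -/

section EulerFactor

open scoped NumberField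

variable {K : Type u} [Field K] [NumberField K] (W : WeierstrassCurve K) (ℓ : ℕ) [Fact ℓ.Prime]

/-- **The Frobenius torsion fact at the split multiplicative places is a theorem**: the named fact
`serreTate_frobenius_smul_torsion_of_hasSplitMultiplicativeReductionAt W ℓ`
(`HasseWeilAbelianEulerFactorFrobenius`; Serre–Tate §1 Lemmas 1–2 + split torus: an arithmetic
Frobenius at `𝔓 ∣ v` acts on `c • P`, `P ∈ E(K̄)^{I_𝔓}[ℓⁿ]`, as multiplication by `N v`), from
`smul_nsmul_torsion_of_hasMultiplicativeReductionAt_of_kodairaNeron_at`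
(`HasseWeilAbelianEulerFactorKodairaNeronProofs`) and Kodaira–Néron at the multiplicative place
(`kodairaNeron_exists_finset_reducesToNonsingular_of_hasMultiplicativeReductionAt`).
[cite: SerreTate1968, §1 Lemma 1 and Lemma 2 (p. 495)]
[cite: SilvermanAEC2009, Exercise 3.5(a)(i), Prop. VII.2.1, Thm. VII.6.1 (PDF pp. 97, 167, 177)] -/
theorem serreTate_frobenius_smul_torsion_of_hasSplitMultiplicativeReductionAt_holds :
    W.serreTate_frobenius_smul_torsion_of_hasSplitMultiplicativeReductionAt ℓ := by
  intro _ v hℓ hv 𝔓 h𝔓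
  obtain ⟨c, hc, h⟩ := W.smul_nsmul_torsion_of_hasMultiplicativeReductionAt_of_kodairaNeron_at ℓ
    (W.kodairaNeron_exists_finset_reducesToNonsingular_of_hasMultiplicativeReductionAt
      hv.hasMultiplicativeReductionAt) hℓ hv.hasMultiplicativeReductionAt h𝔓
  exact ⟨c, hc, fun σ hσ n P hP hPn ↦ (h hσ n P hP hPn).1 hv⟩

/-- **The Frobenius torsion fact at the non-split multiplicative places is a theorem**: the named
fact `serreTate_frobenius_smul_torsion_of_hasNonsplitMultiplicativeReductionAt W ℓ`
(`HasseWeilAbelianEulerFactorTorsion`; Serre–Tate §1 Lemmas 1–2 + non-split torus: an arithmetic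
Frobenius acts on `c • P` as `-(N v)`), from
`smul_nsmul_torsion_of_hasMultiplicativeReductionAt_of_kodairaNeron_at` and Kodaira–Néron at the
multiplicative place.
[cite: SerreTate1968, §1 Lemma 1 and Lemma 2 (p. 495)]
[cite: SilvermanAEC2009, Exercise 3.5(a)(ii), Prop. VII.2.1, Thm. VII.6.1 (PDF pp. 97, 167, 177)] -/
theorem serreTate_frobenius_smul_torsion_of_hasNonsplitMultiplicativeReductionAt_holds :
    W.serreTate_frobenius_smul_torsion_of_hasNonsplitMultiplicativeReductionAt ℓ := by
  intro _ v hℓ hv hns 𝔓 h𝔓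
  obtain ⟨c, hc, h⟩ := W.smul_nsmul_torsion_of_hasMultiplicativeReductionAt_of_kodairaNeron_at ℓ
    (W.kodairaNeron_exists_finset_reducesToNonsingular_of_hasMultiplicativeReductionAt hv) hℓ hv h𝔓
  exact ⟨c, hc, fun σ hσ n P hP hPn ↦ (h hσ n P hP hPn).2 hns⟩

/-- **The Euler factors of an elliptic curve from its Tate module, unconditionally.**  For an
elliptic curve `E/K` over a number field and a prime `ℓ`, the corrected Euler-factor fact
`hasseWeilEulerFactor_geomPoints_of_isElliptic W ℓ` (`HasseWeilAbelianEulerFactorElliptic`):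
`det(1 - σ_v T ∣ (V_ℓ E)_{I_v}) = L_v(E, T)` in `ℚ_ℓ[T]` at every finite place `v ∤ ℓ`, `L_v` the
local polynomial of a minimal model (`1 - a_v T + q_v T²`, `1 ∓ T`, `1`) — Silverman, *AEC*,
C.§16; Serre–Tate (1968), Thm. 3 with §1 (Néron–Ogg–Shafarevich).  Assembled by
`hasseWeilEulerFactor_geomPoints_of_isElliptic_of_codim_of_frobenius_torsion`
(`HasseWeilAbelianEulerFactorFrobenius`) from: the multiplicative case of *ATAEC* Thm. IV.10.2(a)
(`codimFixed_inertia_rationalTate_eq_one_of_hasMultiplicativeReductionAt_holds`,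
`InertiaInvariantsMultiplicativeProofs`); its additive case from Kodaira–Néron at the additive
places (`…_of_kodairaNeron_additive` with
`kodairaNeron_exists_finset_reducesToNonsingular_of_hasAdditiveReductionAt`,
`KodairaNeronAdditiveProofs`); and the two Frobenius torsion facts (this file).  Hence the
Euler factors of `V_ℓ E` at every `v ∤ ℓ` are theorems of the tree.
[cite: SilvermanAEC2009, §C.16 (PDF p. 390)] [cite: SerreTate1968, §1 Lemma 2, §2 Thm. 3]
[cite: SilvermanATAEC1994, Thm. IV.10.2(a) with Cor. IV.9.2(d) (PDF pp. 358, 340)] -/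
theorem hasseWeilEulerFactor_geomPoints_of_isElliptic_holds :
    W.hasseWeilEulerFactor_geomPoints_of_isElliptic ℓ :=
  W.hasseWeilEulerFactor_geomPoints_of_isElliptic_of_codim_of_frobenius_torsion ℓ
    (W.codimFixed_inertia_rationalTate_eq_one_of_hasMultiplicativeReductionAt_holds ℓ)
    (W.codimFixed_inertia_rationalTate_eq_two_of_hasAdditiveReductionAt_of_kodairaNeron_additive ℓ
      fun _ hv ↦ W.kodairaNeron_exists_finset_reducesToNonsingular_of_hasAdditiveReductionAt hv)
    (W.serreTate_frobenius_smul_torsion_of_hasSplitMultiplicativeReductionAt_holds ℓ)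
    (W.serreTate_frobenius_smul_torsion_of_hasNonsplitMultiplicativeReductionAt_holds ℓ)

/-- **The schema instance `hasseWeilEulerFactor_geomPoints W ℓ` for an elliptic `W`**
(`HasseWeilAbelian`; the uncorrected schema has no `[W.IsElliptic]` binder and fails for singular
cubics, `exists_not_hasseWeilEulerFactor_geomPoints`, so only this pointwise form is asserted): the
hypothesis of `LFunction_eq_of_isIsogenous_of_hasseWeilEulerFactor_geomPoints` (Knapp 11.67) and of
`hasRationalEulerFactors_geomPoints_iff`. Silverman, *AEC*, C.§16; Serre–Tate, Thm. 3.
[cite: SilvermanAEC2009, §C.16 (PDF p. 390)] [cite: SerreTate1968, §2 Thm. 3] -/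
theorem hasseWeilEulerFactor_geomPoints_holds_of_isElliptic [W.IsElliptic] :
    W.hasseWeilEulerFactor_geomPoints ℓ :=
  W.hasseWeilEulerFactor_geomPoints_of_of_isElliptic ℓ
    (W.hasseWeilEulerFactor_geomPoints_of_isElliptic_holds ℓ)

end EulerFactor

end WeierstrassCurve

end
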